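import Literature.NumberTheory.EllipticCurves.CastellaGrossiLeeSkinner2022.IMC2DivisibilityAndBDPValueFrame
import HarnessLib

/-!
# Burungale–Castella–Skinner 2025, Theorem 1.2.4: the BDP anticyclotomic main conjecture
# `ch_{Λ_K⁻}(X_Gr(E/K_∞⁻)) = (L_p^BDP(E/K))` — rationally under (irr_ℚ) (a), in `Λ_K^{−,ur}` under
# (sur) (b) — with its inputs Theorem 4.2.1 (b) (the one-sided divisibility under (irr_K), `p` odd)
# and Proposition 4.2.2 (`μ(L_p^BDP) = 0`); NAMED FACTS (typing layer D-0088(4), seat `bsd-littype-03`)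

HONEST FRAMING. This file TYPES published theorems as named facts (`def … : Prop`, nothing
asserted, no `_holds`; D-0014) in the tree's EXISTING vocabulary, and proves only bookkeeping
projections. Typed ≠ proved ≠ endorsed. Siblings in this directory: `HeegnerPointMainConjecture.lean`
(Thm. 1.2.2, Thm. 4.2.1 (a); this seat), `BDPMainConjectureAtTrivialCharacter.lean` (Thm. 1.2.4 (b)
SPECIALISED at the trivial character and composed with CGLS22 Thm. 5.1.3 — the value `𝓕(0)`; here
the characteristic IDEAL itself is recorded), `CyclotomicMainTheoremIntegral.lean` (Thm. 1.1.2 (b)),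
`PPartBSD.lean` (Cor. 1.3.1). What was ABSENT from the tree and is typed here: Thm. 1.2.4 (a), (b) as
statements about the ideal; Thm. 4.2.1 (b); Prop. 4.2.2 (its `L_p^BDP` half). The EISENSTEIN twin of
Thm. 4.2.1 (b) is `CastellaGrossiLeeSkinner2022.proofThm422_exists_isBDPLFunction_isTorsion_charIdeal_dvd`
(same currency; its binder list is copied here).

## Source (read on the store's text `paper:arxiv-2405.00270` = arXiv:2405.00270v2, 12 pp.)

A. Burungale, F. Castella, C. Skinner, *Base change and Iwasawa main conjectures for GL₂*, Int.
Math. Res. Not. IMRN **2025**, no. 8, rnaf082 (doi:10.1093/imrn/rnaf082) = arXiv:2405.00270v2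
(18 Mar 2025). REFEREED / PUBLISHED. Bib key `BurungaleCastellaSkinner2025`.

Setting of §1.2 (pp. 2–3, `[corpus: paper:arxiv-2405.00270 p0002 L40–L50, p0003 L36–L60]`,
verbatim): "(disc) `D_K` is odd and `D_K ≠ −3`", "(Heeg) every prime `ℓ | N` splits in `K`",
"(spl) `p = v v̄` splits in `K` for `v` the prime of `K` above `p` induced by an embedding
`ℚ̄ ↪ ℚ̄_p`, which we fix throughout"; Thm. 1.2.2's data: "Let `E` be an elliptic curve defined over
`ℚ` of conductor `N`, `p` be a prime of good ordinary reduction for `E`, and `K` an imaginary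
quadratic field satisfying (disc), (Heeg), and (spl)"; "In light of the `Λ_K⁻`-adic analogue of the
`p`-adic Waldspurger formula of [BDP13] (see [CH18]), Conjecture 1.2.1 is equivalent to the
prediction that the `p`-adic `L`-function `L_p^BDP(E/K) ∈ Λ_K^{−,ur}` constructed in op. cit.
generates the characteristic ideal of the anticyclotomic Selmer group `X_Gr(E/K_∞⁻)` whose classes
are locally trivial (resp. unrestricted) at the primes above `v̄` (resp. `v`). Here we put
`Λ_K^{−,ur} = Λ_K⁻ ⊗̂_{ℤ_p} ℤ_p^ur`, where `ℤ_p^ur` denotes the completion of the ring of integers of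
the maximal unramified extension of `ℚ_p`. Hence, Theorem 1.2.2 also yields the following.

> **Theorem 1.2.4.** Let `(E, p, K)` be as in Theorem 1.2.2. (a) If `p > 3` satisfies (irr_ℚ), then
> `X_Gr(E/K_∞⁻)` is `Λ_K⁻`-torsion, and `ch_{Λ_K⁻}(X_Gr(E/K_∞⁻)) = (L_p^BDP(E/K))` in
> `Λ_K^{−,ur} ⊗ ℚ_p`. (b) If further `p > 3` satisfies (sur), then the equality of characteristic
> ideals holds in `Λ_K^{−,ur}`."

§4.2 (pp. 8–9, `[ibid. p0008 L44–L62, p0009 L1–L8]`, verbatim; `g ∈ S₂(Γ₀(N))` "an elliptic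
newform", "(irr_K): `ρ̄_g` is irreducible as `G_K`-representation" (p. 7)):

> **Theorem 4.2.1.** Let `g ∈ S₂(Γ₀(N))` be an elliptic newform and `p` an odd prime of good
> ordinary reduction for `g`. Let `K` be an imaginary quadratic field satisfying (disc), (Heeg), and
> (irr_K). Then the following hold: (a) [`HeegnerPointMainConjecture.lean`]. (b) If `K` also
> satisfies (spl), then `X_Gr(g/K_∞⁻)` is `Λ_K⁻`-torsion, and `ch_{Λ_K⁻}(X_Gr(g/K_∞⁻))Λ_K^{−,ur} ⊃
> (L_p^BDP(g/K))` in `Λ_K^{−,ur} ⊗ ℚ_p`. Moreover, if (sur) holds, then both divisibilities hold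
> integrally. *Proof.* Part (a) is contained in [CGS23, Thm. 5.5.2], and part (b) then follows
> from [BCK21, Thm. 5.2]. Under (sur), part (a) follows from [How04, Thm. B], and part (b) again
> from [BCK21, Thm. 5.2].
>
> **Proposition 4.2.2.** Let `g ∈ S₂(Γ₀(N))` be an elliptic newform with good reduction at `p > 2`,
> and suppose `K` is an imaginary quadratic field satisfying (disc), (Heeg), (spl), and (irr_K).
> Then `μ(L_p^Gr(g/K)) = μ(L_p^BDP(g/K)) = 0`. *Proof.* By [Hsi14, Thm. B], `L_p^BDP(g/K)` has
> vanishing `μ`-invariant. Since a direct comparison of the interpolation properties shows that the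
> projection of `L_p^Gr(g/K)` to `Λ_K^{−,ur}` generates the same ideal as `L_p^BDP(g/K)` (see
> [CGS23, Prop. 1.4.5]), the result follows.

## Transcription (word for word → EXISTING tree object; the binder list of each fact is that of the
## Eisenstein twin `CastellaGrossiLeeSkinner2022.proofThm422_…` with BCS's hypotheses)

* "`E/ℚ` of conductor `N`", "`p > 3` good ordinary" / "`p` odd" / "good reduction at `p > 2`" — a
  globally minimal `W : WeierstrassCurve ℚ` (to read `a_p`), `W.IsElliptic`, its newform `f` of level
  `N` (`IsNewformOf W f`; `N = N_E` by Carayol, tree fact `IsNewformOf.level_eq_conductorNorm`),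
  `3 < p` / `p ≠ 2` / `2 < p`, `Rank1Residual.GoodOrd W p` (`p ∤ N ∧ p ∤ a_p`) /
  `W.HasGoodReductionAtPrime p`; (irr_ℚ) `Rank1Residual.Irr W p`; (sur) `Rank1Residual.Surj W p`;
  (irr_K) `(W.baseChange K).HasIrreducibleModPGaloisRep p`. The facts are typed for `g = f_E` only
  (`-- TODO(general form)`: `g` a weight-two newform with arbitrary Hecke field).
* `K`, (Heeg), (spl), (disc) — `IsImaginaryQuadratic K`, `SatisfiesHeegnerHypothesis N K`,
  `((p).primesOver 𝓞_K).ncard = 2`, `Odd (discr K) ∧ discr K ≠ -3`.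
* "`v` induced by the fixed embedding", "`v̄`" — the embedding datum `ι' : ℚ̄_p ≃ ℂ` with the
  compatibility clause `k ∈ v ↔ ‖ι'⁻¹(w.embedding k)‖_p < 1` (through which `IsBDPLFunction` reads
  infinity types), `v̄ ∋ p`, `v̄ ≠ v`.
* "`Γ_K⁻`, `Λ_K⁻`" — `κ : ZpExtension K p` anticyclotomic, a topological generator `γ`
  (`[Fact (κ.IsTopGenerator γ)]`, `Λ = IwasawaAlgebra p = ℤ_p⟦T⟧`, `1 + T ↔ γ`).
* "`X_Gr(E/K_∞⁻)`" — `AcSelmer.XAc (W.baseChange K) p κ vbar ∅ γ` (Castella 2018 Def. 2.2 / CGLS22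
  §2.3 `𝔛_E`: strict = locally trivial at every place above `v̄`, relaxed at `v`, `Σ = ∅`;
  `K_∞`-formulation), `ch_{Λ_K⁻}(X_Gr) = AcSelmer.XAc.charIdeal …`. Reading flag inherited verbatim
  from `BDPMainConjectureAtTrivialCharacter.lean`: `BCS-124-XGr-reading` (BCS §2.1's formal
  Greenberg condition at `w ∣ v̄` is "unramified"; the Introduction's description "locally trivial",
  = CGLS22's `𝔛_E`, is the tree object).
* "`L_p^BDP(E/K) ∈ Λ_K^{−,ur}`" — a FRAME `(Ω_K ≠ 0, Ω_p ∈ R₀ˣ, L ∈ R₀⟦T⟧ = UnrSeries p)` with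
  `IsBDPLFunction ι' v κ γ f Ω_K Ω_p L` (`BDPAnticyclotomicPAdicLFunction.lean`: Castella 2018
  Thm. 3.1's normalisation; at `p ∤ N` this IS [CH18, Def. 3.7 + Prop. 3.8] = CGLS22 Thm. 2.1.1's
  `𝓛_E` = BCS's "`L_p^BDP(E/K)` constructed in op. cit." — one construction), quantified
  EXISTENTIALLY as in every sibling fact; hence each fact below is IMPLIED by the printed statement
  (witness: the printed `L_p^BDP` with its CM periods) and is WEAKER than it. An equality / a
  divisibility of ideals in `R₀⟦T⟧` is insensitive to renormalising `L` by units of `Λ^{−,ur}` only.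
* "`ch_{Λ_K⁻}(X_Gr)Λ_K^{−,ur}`" — the extension of `AcSelmer.XAc.charIdeal` along `Λ = ℤ_p⟦T⟧ →
  R₀⟦T⟧` induced by THE structure map `j : ℤ_p → R₀` (characterised by `j(x) = x` in `ℂ_p`; a
  universally quantified binder with its characterisation, as in the twin).
* "equality in `Λ_K^{−,ur} ⊗ ℚ_p`": `p^a · ch·R₀⟦T⟧ = p^b · (L)` for some `a b : ℕ`; "`⊃ (L)` in
  `Λ^{−,ur} ⊗ ℚ_p`": `p^k · L ∈ ch·R₀⟦T⟧` for some `k`; "integrally": `k = 0`, resp. `ch·R₀⟦T⟧ = (L)`;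
  "`μ(L) = 0`" for `L ∈ R₀⟦T⟧` (`R₀` a complete DVR with uniformizer `p`): SOME coefficient of `L` is a
  unit of `R₀`.

NOT typed here (GAPS reported to the cell, each needing a notion the tree lacks): the `L_p^Gr` half
of Prop. 4.2.2, Thm. 1.4.1, Conj. 4.1.1/4.1.2, Thm. 4.1.3, Cor. 4.1.4, Lemmas 5.1.1–5.1.2, Prop. 5.2.1
(the Pontryagin duals `X^ord(E/K_∞)`, `X_Gr(E/K_∞)` over the `ℤ_p²`-extension as
`ℤ_p⟦Γ_K⟧`-modules and `L_p^Gr ∈ Λ_K^ur`; the receptacle `IwasawaAlgebra₂` and Perrin-Riou's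
`twoVariablePAdicLFunctionK` exist); Thm. 3.2.1 (Wan), Conj. 2.2.1, Hyp. 3.1.1 (Hilbert modular
newforms, `(d+1)`-variable `Λ_M`). No `_holds` is to be expected; consumers take the facts as
hypotheses.

PROVENANCE FLAG `BCS25-IMC-equiv@BSTW` (census flag D1 "BCS25@BSTW"; recorded at the request of
bsd-cited-lead, ASSIGNMENTS.tsv row bsd-littype-03): the printed proofs of Thms. 1.2.2 / 1.2.4 (and
1.1.2) pass through Thm. 4.1.3 ("Proof. This is shown in [BSTW23, §9.3.2] (cf. [CGS23, Prop. 3.2.1]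
or [Cas24, §3.3])", p. 8) and Prop. 5.2.1 ("In view of the two-variable zeta elements of [BSTW23] and
their explicit reciprocity laws", p. 5), where [BSTW23] = A. Burungale, C. Skinner, Y. Tian, X. Wan,
*Zeta elements for elliptic curves and applications*, "preprint, 2023" in BCS's reference list (p. 11)
= arXiv:2409.01350 — a PREPRINT input of a PUBLISHED theorem. Thm. 4.2.1 (b) and Prop. 4.2.2 do
NOT use [BSTW23] (their printed proofs cite [CGS23, Thm. 5.5.2], [How04, Thm. B], [BCK21, Thm. 5.2],
[Hsi14, Thm. B], [CGS23, Prop. 1.4.5]). The facts below are typed as BCS PRINTS them (refereed IMRN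
statements); the flag is informational for the referee desks. Hypotheses dictionary: (irr_ℚ) =
`Rank1Residual.Irr W p`, (sur) = `Rank1Residual.Surj W p`, (irr_K) =
`(W.baseChange K).HasIrreducibleModPGaloisRep p`; (im) = `Rank1Residual.BigIm W p` is NOT a
hypothesis of any fact in this file (it enters Thm. 1.1.2 (b) / Cor. 1.3.1 only).

## References
* [BurungaleCastellaSkinner2025] IMRN 2025 rnaf082 = arXiv:2405.00270v2: §1.2 (pp. 2–3), Thm. 1.2.4;
  §4.2 Thm. 4.2.1, Prop. 4.2.2 (pp. 8–9); §5.2 "Proof of Theorem 1.2.2 and Theorem 1.2.4" (p. 11).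
* [CastellaHsieh2018] Math. Ann. 370, Def. 3.7 / Prop. 3.8 (the construction of `L_p^BDP`);
  [Castella2018] Thm. 3.1 (the normalisation `IsBDPLFunction`); [BertoliniDarmonPrasanna2013] §5.
* [BurungaleCastellaKim2021] Algebra Number Theory 15 (2021), Thm. 5.2 (source of Thm. 4.2.1 (b)).
* [Hsieh2014] Doc. Math. 19 (2014), Thm. B (source of Prop. 4.2.2).
* [CastellaGrossiLeeSkinner2022] Invent. Math. 227: §2.3 (`𝔛_E`), Thm. 2.1.1, proof of Thm. 4.2.2
  (tree `IMC2DivisibilityAndBDPValueFrame.lean`, the Eisenstein twin).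
-/


noncomputable section

open scoped Classical

open PowerSeries WeierstrassCurve NumberField IsDedekindDomain Field
  Literature.NumberTheory.EllipticCurves Literature.NumberTheory.EllipticCurves.ModularForms
  Literature.NumberTheory.QuadraticFields Literature.NumberTheory.EllipticCurves.Rank1Residual
  Literature.NumberTheory.EllipticCurves.Castella2018

namespace Literature.NumberTheory.EllipticCurves.BurungaleCastellaSkinner2025

/-- **Burungale–Castella–Skinner, IMRN 2025 (rnaf082) = arXiv:2405.00270v2, Theorem 1.2.4 (a)
(§1.2, p. 3)**: "Let `(E, p, K)` be as in Theorem 1.2.2 [`E/ℚ` of conductor `N`, `p` good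
ordinary, `K` imaginary quadratic with (disc), (Heeg), (spl)]. (a) If `p > 3` satisfies (irr_ℚ),
then `X_Gr(E/K_∞⁻)` is `Λ_K⁻`-torsion, and `ch_{Λ_K⁻}(X_Gr(E/K_∞⁻)) = (L_p^BDP(E/K))` in
`Λ_K^{−,ur} ⊗ ℚ_p`" — `X_Gr(E/K_∞⁻)` "whose classes are locally trivial (resp. unrestricted) at the
primes above `v̄` (resp. `v`)", `L_p^BDP(E/K) ∈ Λ_K^{−,ur}` "constructed in [BDP13] (see [CH18])".
TRANSCRIBED (module docstring): `W` globally minimal with newform `f` of level `N`, `3 < p`,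
`GoodOrd W p`, `Irr W p`; `K` imaginary quadratic with (Heeg) for `N`, (spl), (disc); `v` the prime
of the embedding datum `ι'`, `v̄ ∋ p` the other prime; `κ` anticyclotomic with topological
generator `γ`; `X_Gr(E/K_∞⁻) = AcSelmer.XAc (W.baseChange K) p κ vbar ∅ γ` (reading flag
`BCS-124-XGr-reading`). Conclusion: a frame `(Ω_K ≠ 0, Ω_p ∈ R₀ˣ, L)` with `IsBDPLFunction ι' v κ γ
f Ω_K Ω_p L` such that `X_Gr` is `Λ`-torsion and, along THE structure map `j : ℤ_p → R₀`
(`j(x) = x` in `ℂ_p`), `p^a · ch_Λ(X_Gr)·R₀⟦T⟧ = p^b · (L)` for some `a b : ℕ`. Frame ∃-quantified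
⇒ WEAKER than print. PUBLISHED THEOREM (proof p. 11).
[cite: BurungaleCastellaSkinner2025, Thm. 1.2.4 (a) (§1.2, p. 3 of arXiv:2405.00270v2), setting of §1.2 (pp. 2–3)]
[cite: CastellaHsieh2018, Prop. 3.8 (the construction of `L_p^BDP`, = CGLS22 Thm. 2.1.1)]
[cite: Castella2018, Thm. 3.1 (the normalisation `IsBDPLFunction`)] -/
def thm124a_exists_isBDPLFunction_isTorsion_charIdeal_eq_rat : Prop :=
  ∀ {p : ℕ} [Fact p.Prime] (ι' : PadicAlgCl p ≃+* ℂ) (W : WeierstrassCurve ℚ) [W.IsElliptic]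
    [W.IsGloballyMinimal] (K : Type) [Field K] [NumberField K] (v vbar : HeightOneSpectrum (𝓞 K))
    (κ : ZpExtension K p) (γ : absoluteGaloisGroup K) [Fact (κ.IsTopGenerator γ)] {N : ℕ} [NeZero N]
    {f : CuspForm (CongruenceSubgroup.Gamma0 N) 2} (_ : IsNewformOf W f),
    3 < p → GoodOrd W p → Irr W p →
    IsImaginaryQuadratic K → SatisfiesHeegnerHypothesis N K →
      ((Ideal.span {(p : ℤ)}).primesOver (𝓞 K)).ncard = 2 →
      Odd (NumberField.discr K) → NumberField.discr K ≠ -3 →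
    (∀ (w : InfinitePlace K) (k : 𝓞 K), k ∈ v.asIdeal ↔ ‖ι'.symm (w.embedding (k : K))‖ < 1) →
      ((p : ℕ) : 𝓞 K) ∈ vbar.asIdeal → vbar ≠ v →
    κ.IsAnticyclotomic →
    ∃ (ΩK : ℂ) (Ωp : (unrIntegers p)ˣ) (L : UnrSeries p),
      ΩK ≠ 0 ∧ IsBDPLFunction ι' v κ γ f ΩK ((Ωp : unrIntegers p) : ℂ_[p]) L ∧
      Module.IsTorsion (IwasawaAlgebra p) (AcSelmer.XAc (W.baseChange K) p κ vbar ∅ γ) ∧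
      ∀ (j : ℤ_[p] →+* unrIntegers p),
        (∀ x : ℤ_[p], ((j x : unrIntegers p) : ℂ_[p]) = algebraMap ℚ_[p] ℂ_[p] (x : ℚ_[p])) →
        ∃ a b : ℕ,
          Ideal.span {C ((p : unrIntegers p) ^ a)} *
              (AcSelmer.XAc.charIdeal (W.baseChange K) p κ vbar ∅ γ).map (PowerSeries.map j) =
            Ideal.span {C ((p : unrIntegers p) ^ b)} * Ideal.span {L}

/-- **Burungale–Castella–Skinner, IMRN 2025 = arXiv:2405.00270v2, Theorem 1.2.4 (b) (§1.2, p. 3)**: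
"(b) If further `p > 3` satisfies (sur), then the equality of characteristic ideals
[`ch_{Λ_K⁻}(X_Gr(E/K_∞⁻)) = (L_p^BDP(E/K))`] holds in `Λ_K^{−,ur}`." Transcribed exactly as part
(a) (same binders, `Surj W p` in place of `Irr W p`) with the INTEGRAL conclusion
`ch_Λ(X_Gr)·R₀⟦T⟧ = (L)` along the structure map `j`. The sibling fact
`thm124b_thm513_generator_constantCoeff` is this equality SPECIALISED at the trivial character and
composed with CGLS22 Thm. 5.1.3; here the ideal itself is recorded. Frame ∃-quantified ⇒ WEAKER
than print. PUBLISHED THEOREM.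
[cite: BurungaleCastellaSkinner2025, Thm. 1.2.4 (b) (§1.2, p. 3 of arXiv:2405.00270v2), (sur) (p. 3)]
[cite: CastellaHsieh2018, Prop. 3.8 (the construction of `L_p^BDP`)]
[cite: Castella2018, Thm. 3.1 (the normalisation `IsBDPLFunction`)] -/
def thm124b_exists_isBDPLFunction_isTorsion_charIdeal_eq : Prop :=
  ∀ {p : ℕ} [Fact p.Prime] (ι' : PadicAlgCl p ≃+* ℂ) (W : WeierstrassCurve ℚ) [W.IsElliptic]
    [W.IsGloballyMinimal] (K : Type) [Field K] [NumberField K] (v vbar : HeightOneSpectrum (𝓞 K))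
    (κ : ZpExtension K p) (γ : absoluteGaloisGroup K) [Fact (κ.IsTopGenerator γ)] {N : ℕ} [NeZero N]
    {f : CuspForm (CongruenceSubgroup.Gamma0 N) 2} (_ : IsNewformOf W f),
    3 < p → GoodOrd W p → Surj W p →
    IsImaginaryQuadratic K → SatisfiesHeegnerHypothesis N K →
      ((Ideal.span {(p : ℤ)}).primesOver (𝓞 K)).ncard = 2 →
      Odd (NumberField.discr K) → NumberField.discr K ≠ -3 →
    (∀ (w : InfinitePlace K) (k : 𝓞 K), k ∈ v.asIdeal ↔ ‖ι'.symm (w.embedding (k : K))‖ < 1) →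
      ((p : ℕ) : 𝓞 K) ∈ vbar.asIdeal → vbar ≠ v →
    κ.IsAnticyclotomic →
    ∃ (ΩK : ℂ) (Ωp : (unrIntegers p)ˣ) (L : UnrSeries p),
      ΩK ≠ 0 ∧ IsBDPLFunction ι' v κ γ f ΩK ((Ωp : unrIntegers p) : ℂ_[p]) L ∧
      Module.IsTorsion (IwasawaAlgebra p) (AcSelmer.XAc (W.baseChange K) p κ vbar ∅ γ) ∧
      ∀ (j : ℤ_[p] →+* unrIntegers p),
        (∀ x : ℤ_[p], ((j x : unrIntegers p) : ℂ_[p]) = algebraMap ℚ_[p] ℂ_[p] (x : ℚ_[p])) →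
        (AcSelmer.XAc.charIdeal (W.baseChange K) p κ vbar ∅ γ).map (PowerSeries.map j) =
          Ideal.span {L}

/-- **Burungale–Castella–Skinner 2025, Theorem 4.2.1 (b) with its "Moreover" clause (§4.2, p. 8)**,
for the newform of an elliptic curve: "Let `g ∈ S₂(Γ₀(N))` be an elliptic newform and `p` an odd
prime of good ordinary reduction for `g`. Let `K` be an imaginary quadratic field satisfying (disc),
(Heeg), and (irr_K). … (b) If `K` also satisfies (spl), then `X_Gr(g/K_∞⁻)` is `Λ_K⁻`-torsion, and
`ch_{Λ_K⁻}(X_Gr(g/K_∞⁻))Λ_K^{−,ur} ⊃ (L_p^BDP(g/K))` in `Λ_K^{−,ur} ⊗ ℚ_p`. Moreover, if (sur) holds,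
then both divisibilities hold integrally" ("part (b) then follows from [BCK21, Thm. 5.2]").
Transcribed as Thm. 1.2.4 (same binders) with `p ≠ 2` in place of `3 < p` and (irr_K)
`(W.baseChange K).HasIrreducibleModPGaloisRep p` in place of (irr_ℚ): a frame with `X_Gr`
`Λ`-torsion and, along `j`, `p^k · L ∈ ch_Λ(X_Gr)·R₀⟦T⟧` for some `k` — the IRREDUCIBLE twin of
`CastellaGrossiLeeSkinner2022.proofThm422_…` (same shape) — and `L ∈ ch_Λ(X_Gr)·R₀⟦T⟧` if
moreover `Surj W p`. Valid at `p = 3`. Frame ∃-quantified ⇒ WEAKER than print. PUBLISHED.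
-- TODO(general form): `g` a weight-two newform with arbitrary Hecke field.
[cite: BurungaleCastellaSkinner2025, Thm. 4.2.1 (b) and "Moreover" (§4.2, p. 8 of arXiv:2405.00270v2), (irr_K) (p. 7)]
[cite: BurungaleCastellaKim2021, Thm. 5.2 (the source, as cited by BCS)]
[cite: Castella2018, Thm. 3.1 (the normalisation `IsBDPLFunction`)] -/
def thm421b_exists_isBDPLFunction_isTorsion_mem_charIdeal : Prop :=
  ∀ {p : ℕ} [Fact p.Prime] (ι' : PadicAlgCl p ≃+* ℂ) (W : WeierstrassCurve ℚ) [W.IsElliptic]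
    [W.IsGloballyMinimal] (K : Type) [Field K] [NumberField K] (v vbar : HeightOneSpectrum (𝓞 K))
    (κ : ZpExtension K p) (γ : absoluteGaloisGroup K) [Fact (κ.IsTopGenerator γ)] {N : ℕ} [NeZero N]
    {f : CuspForm (CongruenceSubgroup.Gamma0 N) 2} (_ : IsNewformOf W f),
    p ≠ 2 → GoodOrd W p →
    IsImaginaryQuadratic K → SatisfiesHeegnerHypothesis N K →
      ((Ideal.span {(p : ℤ)}).primesOver (𝓞 K)).ncard = 2 →
      Odd (NumberField.discr K) → NumberField.discr K ≠ -3 →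
      (W.baseChange K).HasIrreducibleModPGaloisRep p →
    (∀ (w : InfinitePlace K) (k : 𝓞 K), k ∈ v.asIdeal ↔ ‖ι'.symm (w.embedding (k : K))‖ < 1) →
      ((p : ℕ) : 𝓞 K) ∈ vbar.asIdeal → vbar ≠ v →
    κ.IsAnticyclotomic →
    ∃ (ΩK : ℂ) (Ωp : (unrIntegers p)ˣ) (L : UnrSeries p),
      ΩK ≠ 0 ∧ IsBDPLFunction ι' v κ γ f ΩK ((Ωp : unrIntegers p) : ℂ_[p]) L ∧
      Module.IsTorsion (IwasawaAlgebra p) (AcSelmer.XAc (W.baseChange K) p κ vbar ∅ γ) ∧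
      ∀ (j : ℤ_[p] →+* unrIntegers p),
        (∀ x : ℤ_[p], ((j x : unrIntegers p) : ℂ_[p]) = algebraMap ℚ_[p] ℂ_[p] (x : ℚ_[p])) →
        (∃ k : ℕ, C ((p : unrIntegers p) ^ k) * L ∈
          (AcSelmer.XAc.charIdeal (W.baseChange K) p κ vbar ∅ γ).map (PowerSeries.map j)) ∧
        (Surj W p →
          L ∈ (AcSelmer.XAc.charIdeal (W.baseChange K) p κ vbar ∅ γ).map (PowerSeries.map j))

/-- **Burungale–Castella–Skinner 2025, Proposition 4.2.2 (§4.2, pp. 8–9), the `L_p^BDP` half**, for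
the newform of an elliptic curve: "Let `g ∈ S₂(Γ₀(N))` be an elliptic newform with good reduction at
`p > 2`, and suppose `K` is an imaginary quadratic field satisfying (disc), (Heeg), (spl), and
(irr_K). Then `μ(L_p^Gr(g/K)) = μ(L_p^BDP(g/K)) = 0`. *Proof.* By [Hsi14, Thm. B], `L_p^BDP(g/K)`
has vanishing `μ`-invariant …". Transcribed (frame currency; binders as in Thm. 1.2.4 without `v̄`
and WITHOUT ordinarity): `W` elliptic with newform `f` of level `N`, `2 < p`, GOOD reduction
`W.HasGoodReductionAtPrime p`, `K` imaginary quadratic with (Heeg), (spl), (disc), (irr_K); `v ∋ p`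
the prime of `ι'`; `κ` anticyclotomic with topological generator `γ`: there is a frame
`(Ω_K ≠ 0, Ω_p ∈ R₀ˣ, L)` with `IsBDPLFunction ι' v κ γ f Ω_K Ω_p L` and `μ(L) = 0`, i.e. SOME
coefficient of `L ∈ R₀⟦T⟧` is a unit of `R₀`. The `L_p^Gr` half (two-variable, `Λ_K^ur`) has no tree
object and is NOT typed. Frame ∃-quantified ⇒ WEAKER than print. PUBLISHED (source [Hsi14, Thm. B]).
-- TODO(general form): `g` a weight-two newform with arbitrary Hecke field; the `L_p^Gr` half.
[cite: BurungaleCastellaSkinner2025, Prop. 4.2.2 and its proof (§4.2, pp. 8–9 of arXiv:2405.00270v2)]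
[cite: Hsieh2014, Thm. B (the source of the `μ = 0` statement, as cited by BCS)]
[cite: Castella2018, Thm. 3.1 (the normalisation `IsBDPLFunction`)] -/
def prop422_exists_isBDPLFunction_mu_eq_zero : Prop :=
  ∀ {p : ℕ} [Fact p.Prime] (ι' : PadicAlgCl p ≃+* ℂ) (W : WeierstrassCurve ℚ) [W.IsElliptic]
    (K : Type) [Field K] [NumberField K] (v : HeightOneSpectrum (𝓞 K))
    (κ : ZpExtension K p) (γ : absoluteGaloisGroup K) {N : ℕ} [NeZero N]
    {f : CuspForm (CongruenceSubgroup.Gamma0 N) 2} (_ : IsNewformOf W f),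
    2 < p → W.HasGoodReductionAtPrime p →
    IsImaginaryQuadratic K → SatisfiesHeegnerHypothesis N K →
      ((Ideal.span {(p : ℤ)}).primesOver (𝓞 K)).ncard = 2 →
      Odd (NumberField.discr K) → NumberField.discr K ≠ -3 →
      (W.baseChange K).HasIrreducibleModPGaloisRep p →
    ((p : ℕ) : 𝓞 K) ∈ v.asIdeal →
    (∀ (w : InfinitePlace K) (k : 𝓞 K), k ∈ v.asIdeal ↔ ‖ι'.symm (w.embedding (k : K))‖ < 1) →
    κ.IsAnticyclotomic → κ.IsTopGenerator γ →
    ∃ (ΩK : ℂ) (Ωp : (unrIntegers p)ˣ) (L : UnrSeries p),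
      ΩK ≠ 0 ∧ IsBDPLFunction ι' v κ γ f ΩK ((Ωp : unrIntegers p) : ℂ_[p]) L ∧
      ∃ k : ℕ, IsUnit (PowerSeries.coeff k L)

/-! ### Bookkeeping between the facts -/

section Bookkeeping

variable {p : ℕ} [Fact p.Prime] (ι' : PadicAlgCl p ≃+* ℂ) (W : WeierstrassCurve ℚ) [W.IsElliptic]
  [W.IsGloballyMinimal] (K : Type) [Field K] [NumberField K] (v vbar : HeightOneSpectrum (𝓞 K))
  (κ : ZpExtension K p) (γ : absoluteGaloisGroup K) [Fact (κ.IsTopGenerator γ)] {N : ℕ} [NeZero N]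
  {f : CuspForm (CongruenceSubgroup.Gamma0 N) 2}

/-- **Theorem 1.2.4 (b) ⇒ Theorem 1.2.4 (a)'s conclusion on the (sur)-locus** (`a = b = 0`), and
the integral divisibility `L ∈ ch_Λ(X_Gr)·R₀⟦T⟧` (the "Moreover" clause of Thm. 4.2.1 (b) at
`p > 3`). Bookkeeping only. [cite: BurungaleCastellaSkinner2025, Thm. 1.2.4 (§1.2, p. 3), Thm. 4.2.1 (b) (p. 8)] -/
theorem rat_and_mem_of_thm124b (h : thm124b_exists_isBDPLFunction_isTorsion_charIdeal_eq)
    (hf : IsNewformOf W f) (hp : 3 < p) (hord : GoodOrd W p) (hsur : Surj W p)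
    (hK : IsImaginaryQuadratic K) (hH : SatisfiesHeegnerHypothesis N K)
    (hspl : ((Ideal.span {(p : ℤ)}).primesOver (𝓞 K)).ncard = 2)
    (hodd : Odd (NumberField.discr K)) (h3 : NumberField.discr K ≠ -3)
    (hv : ∀ (w : InfinitePlace K) (k : 𝓞 K), k ∈ v.asIdeal ↔ ‖ι'.symm (w.embedding (k : K))‖ < 1)
    (hvbar : ((p : ℕ) : 𝓞 K) ∈ vbar.asIdeal) (hne : vbar ≠ v) (hκ : κ.IsAnticyclotomic) :
    ∃ (ΩK : ℂ) (Ωp : (unrIntegers p)ˣ) (L : UnrSeries p),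
      ΩK ≠ 0 ∧ IsBDPLFunction ι' v κ γ f ΩK ((Ωp : unrIntegers p) : ℂ_[p]) L ∧
      Module.IsTorsion (IwasawaAlgebra p) (AcSelmer.XAc (W.baseChange K) p κ vbar ∅ γ) ∧
      ∀ (j : ℤ_[p] →+* unrIntegers p),
        (∀ x : ℤ_[p], ((j x : unrIntegers p) : ℂ_[p]) = algebraMap ℚ_[p] ℂ_[p] (x : ℚ_[p])) →
        (∃ a b : ℕ,
          Ideal.span {C ((p : unrIntegers p) ^ a)} *
              (AcSelmer.XAc.charIdeal (W.baseChange K) p κ vbar ∅ γ).map (PowerSeries.map j) =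
            Ideal.span {C ((p : unrIntegers p) ^ b)} * Ideal.span {L}) ∧
        L ∈ (AcSelmer.XAc.charIdeal (W.baseChange K) p κ vbar ∅ γ).map (PowerSeries.map j) := by
  obtain ⟨ΩK, Ωp, L, hΩ, hL, htors, heq⟩ :=
    h ι' W K v vbar κ γ hf hp hord hsur hK hH hspl hodd h3 hv hvbar hne hκ
  refine ⟨ΩK, Ωp, L, hΩ, hL, htors, fun j hj ↦ ⟨⟨0, 0, by rw [heq j hj]⟩, ?_⟩⟩
  rw [heq j hj]
  exact Ideal.mem_span_singleton_self L

/-- **Theorem 4.2.1 (b) at `p > 3` under (sur) gives the integral one-sided divisibility**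
`L ∈ ch_Λ(X_Gr)·R₀⟦T⟧` ((sur) ⇒ (irr_ℚ) ⇒ (irr_K) is NOT used: (irr_K) is taken as a hypothesis,
as printed). Bookkeeping only. [cite: BurungaleCastellaSkinner2025, Thm. 4.2.1 (b) "Moreover" (§4.2, p. 8)] -/
theorem mem_charIdeal_map_of_thm421b (h : thm421b_exists_isBDPLFunction_isTorsion_mem_charIdeal)
    (hf : IsNewformOf W f) (hp : p ≠ 2) (hord : GoodOrd W p) (hsur : Surj W p)
    (hK : IsImaginaryQuadratic K) (hH : SatisfiesHeegnerHypothesis N K)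
    (hspl : ((Ideal.span {(p : ℤ)}).primesOver (𝓞 K)).ncard = 2)
    (hodd : Odd (NumberField.discr K)) (h3 : NumberField.discr K ≠ -3)
    (hirrK : (W.baseChange K).HasIrreducibleModPGaloisRep p)
    (hv : ∀ (w : InfinitePlace K) (k : 𝓞 K), k ∈ v.asIdeal ↔ ‖ι'.symm (w.embedding (k : K))‖ < 1)
    (hvbar : ((p : ℕ) : 𝓞 K) ∈ vbar.asIdeal) (hne : vbar ≠ v) (hκ : κ.IsAnticyclotomic) :
    ∃ (ΩK : ℂ) (Ωp : (unrIntegers p)ˣ) (L : UnrSeries p),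
      ΩK ≠ 0 ∧ IsBDPLFunction ι' v κ γ f ΩK ((Ωp : unrIntegers p) : ℂ_[p]) L ∧
      Module.IsTorsion (IwasawaAlgebra p) (AcSelmer.XAc (W.baseChange K) p κ vbar ∅ γ) ∧
      ∀ (j : ℤ_[p] →+* unrIntegers p),
        (∀ x : ℤ_[p], ((j x : unrIntegers p) : ℂ_[p]) = algebraMap ℚ_[p] ℂ_[p] (x : ℚ_[p])) →
        L ∈ (AcSelmer.XAc.charIdeal (W.baseChange K) p κ vbar ∅ γ).map (PowerSeries.map j) := by
  obtain ⟨ΩK, Ωp, L, hΩ, hL, htors, hdiv⟩ :=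
    h ι' W K v vbar κ γ hf hp hord hK hH hspl hodd h3 hirrK hv hvbar hne hκ
  exact ⟨ΩK, Ωp, L, hΩ, hL, htors, fun j hj ↦ (hdiv j hj).2 hsur⟩

end Bookkeeping

end Literature.NumberTheory.EllipticCurves.BurungaleCastellaSkinner2025

end
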